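import Summits.ABC.IUTFork.LDHGenuinePerImageFloorShellDatum
import Summits.ABC.IUTFork.LDHGenuinePerImageSharpWildPoleLFloors
import HarnessLib

/-!
# The fork at [IUTchIII] Corollary 3.12, L-DH level, READING (P): the rational-point test with the WILD DIFFERENT at `2`, the W1 poles, THE POLE
# `l`, AND THE WILD LOG-SHELL TERM («DS+W+I1+L+SHELL»; abc-iut cell, crux ThetaPartII = stmt-ABC-19678; R-H round-4 row O-18, family
# «C:PERIMAGE-LEVEL»: the one-`l` test that part 4's uniform theorem iterates over the poles of order `2` and `4`)

Record-only PROOF file (D-0012) of the abc-iut cell (seat abc-iut-L5-t8, gen 14). TAKES NO SIDE on [IUTchIII] Cor. 3.12. The MERGE of two landed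
one-`l` tests at a rational point `q ∈ ℚ ∖ {0,1}`, `j(q) = N/∏_{p∈I} p^{e_p}`: abc-iut-rcat-tst-1's `Cor22.cor312PerImageOf_ratPoint_sharp_wild_poleL`
(★ p541073: floors on the different exponent — `χ_p − 1/m_p` at the poles `p ≠ 2, l` (`χ_p = 2` at a W1 pole over `3`, `5`), `1` at `2` (`√−1 ∈ K`),
`2 − 1/(l−1)` AT THE POLE `l ∈ I` of order `e_l = 2t`, `l ∤ t` (★ p539739), `½`/`¾` at `3`, `5 ∉ I`) and abc-iut-c312-d1's
`Cor22.cor312PerImageOf_ratPoint_shell` (the wild LOG-SHELL term `((l+5)/4)·Σ_{p∈Psh}(a_p − p^{a_p}/m_p)·log p` at admissible shell poles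
`Psh ⊆ I`, `p ≠ 2, l`, `l ∤ p − 1`). Every floor, every divisibility and every shell pair is CONSUMED BY NAME from those files' sources
(`under_ratPoint_spec`, `mem_badPlacesAvoid_ratPoint_of_natGenerator_eq`, `l_dvd_ramificationIdx'_of_mem_badPlacesAvoid`,
`div_gcd_thirty_dvd_ramificationIdx_F`, `sub_one_dvd_ramificationIdx_int`, `dvd_ramificationIdx'_ratPoint_of_forall`,
`ramificationIdx_le_multiplicity_differentIdeal_over_two`, `GenuineK.sub_one_le_multiplicity_differentIdeal_placeOf_wild_ratPoint`,
`GenuineK.sub_one_le_multiplicity_differentIdeal_placeOf_pole_ratPoint`, `sub_one_dvd_ramificationIdx'_ratPoint_l`, `weight_dvd_ramificationIdx_int_of_mem`,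
`TensorPacketContentShell.exists_shellPair_ge_of_forall_ne` / `exists_shellPair_nonneg`) through the floors lemma `ThetaVolumeDatumAt.floors_sharp_wild_poleL_ratPoint` (`LDHGenuinePerImageSharpWildPoleLFloors`) and the floors+shell
sufficiency `ThetaVolumeDatumAt.cor312PerImageOf_of_le_floor_shell` (`LDHGenuinePerImageFloorShellDatum`); the row-normal-form bookkeeping of
both files is private there and is re-done here (adapted, with attribution in the proof).

* **`Cor22.cor312PerImageOf_ratPoint_sharp_wild_poleL_shell`** — hypotheses of ★ p541073 plus shell data `(Psh, a)`; if
  `κ_l·log q^{∤2l}(q) ≤ ((l+5)/4 − 1)·( Σ_{p∈I, p≠2, p≠l} (χ_p − 1/m_p)·log p + log 2 + [3∉I]·½·log 3 + [5∉I]·¾·log 5 + (2 − 1/(l−1))·log l )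
     + ((l+5)/4)·Σ_{p∈Psh} (a_p − p^{a_p}/m_p)·log p + ((l+5)/4)·log π`
  then `T.Cor312PerImageOf` at EVERY genuine Θ-volume datum `T` of `(q, l)`.

HONEST SCOPE: the (Ind2) of reading (P) is the tree's FULL lattice-automorphism container; nothing here asserts the existence of Θ-data,
Cor. 3.12 in general or in print's reading, or abc; proved-as-typed ≠ in print. [cite: Mochizuki2012, IUTchI Def. 3.1 (a)(b)(c) p. 61–62; IUTchIII
Cor. 3.12 p. 173–174, proof Step (x) p. 181; IUTchIV Prop. 1.2 (i)(ii) p. 10, Thm. 1.10 p. 22, Step (ii) p. 24, Step (v) p. 27–29]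
[cite: MochizukiGenEll2010, Prop. 1.7 (i) p. 9–10] [cite: SilvermanATAEC1994, V.5 Thm. 5.3] [cite: SerreLocalFields1979, Ch. III §6 Prop. 13]
[cite: NeukirchANT1999, Ch. II (5.5), (6.8), Ch. III (2.6)] [cite: DupuyHilado2025, §4.9, §4.12] [claim: Mochizuki2012, status: disputed] for every
IUT quotation. PROOF-ONLY: no definitions, no new `Prop`, no instance, no notation.
-/

noncomputable section

open NumberField IsDedekindDomain Ideal Module

namespace Literature.IUT.LogVolume.Cor22

open Literature.NumberTheory.DiophantineGeometry.GenEll Summit.ABC.IUTFork Literature.IUT.HodgeTheaters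
open Literature.NumberTheory.NumberFields Literature.NumberTheory.GaloisRepresentations.Ultrametric
open Literature.NumberTheory.DiophantineGeometry.UniformABCConjecture Rat.HeightOneSpectrum
open Summit.ABC.IUTFork.Thm311.Real Summit.ABC.IUTFork.Conditional Summit.ABC.IUTFork.Cor312Prov
open Literature.IUT.LogThetaLattice

variable {q : ℚ} {l : ℕ}

section Bookkeeping

variable {I : Finset ℕ} {e : ℕ → ℕ}

/-- Rearranging the floor sum into the row-normal form of the statement (★ p541073's private `sum_floor_eq_pl`). [folklore] -/
private theorem sum_floor_eq_fs (h7 : 7 ≤ l) (B : ℕ → ℝ)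
    (hBA : ∀ p ∈ I.filter (fun p => p ≠ 2 ∧ p ≠ l),
      B p = (if (p = 3 ∨ p = 5) ∧ 2 ∣ e p ∧ ¬ p ∣ e p / 2 then (2 : ℝ) else 1)
        - ((l * Nat.lcm (30 / Nat.gcd 30 (e p)) (if p = 3 then 2 else if p = 5 then 4 else 1) : ℕ) : ℝ)⁻¹)
    (hB2 : B 2 = 1) (hBl : B l = 2 - ((l - 1 : ℕ) : ℝ)⁻¹) (hB3 : 3 ∉ I → B 3 = 1 - 2⁻¹)
    (hB5 : 5 ∉ I → B 5 = 1 - 4⁻¹) :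
    ∑ p ∈ I.filter (fun p => p ≠ 2 ∧ p ≠ l) ∪ ({2, l} ∪ ({3, 5} \ I)), B p * Real.log p =
      (∑ p ∈ I.filter (fun p => p ≠ 2 ∧ p ≠ l),
          ((if (p = 3 ∨ p = 5) ∧ 2 ∣ e p ∧ ¬ p ∣ e p / 2 then (2 : ℝ) else 1)
            - ((l * Nat.lcm (30 / Nat.gcd 30 (e p)) (if p = 3 then 2 else if p = 5 then 4 else 1) : ℕ) : ℝ)⁻¹)
            * Real.log p)
        + Real.log 2
        + (if 3 ∈ I then 0 else 2⁻¹ * Real.log 3)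
        + (if 5 ∈ I then 0 else (3 / 4 : ℝ) * Real.log 5)
        + (2 - ((l - 1 : ℕ) : ℝ)⁻¹) * Real.log l := by
  have hl2 : l ≠ 2 := by omega
  have hl3 : l ≠ 3 := by omega
  have hl5 : l ≠ 5 := by omega
  have hdisjA : Disjoint (I.filter (fun p => p ≠ 2 ∧ p ≠ l)) ({2, l} ∪ ({3, 5} \ I)) := by
    refine Finset.disjoint_left.mpr fun p hpA hpB => ?_
    obtain ⟨hpI, hP⟩ := Finset.mem_filter.mp hpA
    rcases Finset.mem_union.mp hpB with h | h
    · simp only [Finset.mem_insert, Finset.mem_singleton] at h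
      omega
    · exact (Finset.mem_sdiff.mp h).2 hpI
  have hdisjB : Disjoint ({2, l} : Finset ℕ) ({3, 5} \ I) := by
    refine Finset.disjoint_left.mpr fun p hp hp' => ?_
    have h35 := (Finset.mem_sdiff.mp hp').1
    simp only [Finset.mem_insert, Finset.mem_singleton] at hp h35
    omega
  rw [Finset.sum_union hdisjA, Finset.sum_union hdisjB]
  have hA : ∑ p ∈ I.filter (fun p => p ≠ 2 ∧ p ≠ l), B p * Real.log p =
      ∑ p ∈ I.filter (fun p => p ≠ 2 ∧ p ≠ l),
        ((if (p = 3 ∨ p = 5) ∧ 2 ∣ e p ∧ ¬ p ∣ e p / 2 then (2 : ℝ) else 1)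
          - ((l * Nat.lcm (30 / Nat.gcd 30 (e p)) (if p = 3 then 2 else if p = 5 then 4 else 1) : ℕ) : ℝ)⁻¹)
          * Real.log p :=
    Finset.sum_congr rfl fun p hp => by rw [hBA p hp]
  have hB : ∑ p ∈ ({2, l} : Finset ℕ), B p * Real.log p =
      Real.log 2 + (2 - ((l - 1 : ℕ) : ℝ)⁻¹) * Real.log l := by
    rw [Finset.sum_pair hl2.symm, hB2, hBl]
    ring
  have hC : ∑ p ∈ ({3, 5} : Finset ℕ) \ I, B p * Real.log p =
      (if 3 ∈ I then 0 else 2⁻¹ * Real.log 3) + (if 5 ∈ I then 0 else (3 / 4 : ℝ) * Real.log 5) := by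
    rw [Finset.sdiff_eq_filter, Finset.sum_filter, Finset.sum_pair (by norm_num : (3 : ℕ) ≠ 5)]
    congr 1
    · by_cases h3 : 3 ∈ I
      · rw [if_neg (not_not.mpr h3), if_pos h3]
      · rw [if_pos h3, if_neg h3, hB3 h3]; norm_num
    · by_cases h5 : 5 ∈ I
      · rw [if_neg (not_not.mpr h5), if_pos h5]
      · rw [if_pos h5, if_neg h5, hB5 h5]; norm_num
  rw [hA, hB, hC]
  ring

end Bookkeeping

variable {N D : ℕ} {I : Finset ℕ} {e : ℕ → ℕ}

/-- **RATIONAL POINTS: THE WILD DIFFERENT AT `2`, THE W1 POLES, THE POLE `l`, AND THE WILD LOG-SHELL TERM, IN ONE TEST** (statement in words in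
the module docstring; `m_p = l·lcm(30/gcd(30,e_p), c_p)`): `T.Cor312PerImageOf` ([IUTchIII] Cor. 3.12 in the cell's READING (P), AS TYPED) at EVERY
genuine Θ-volume datum `T` of `(q, l)`, the pole `l ∈ I` of order `e_l = 2t`, `l ∤ t`, shell poles `Psh`. The floors and shell pairs are THEOREMS
at every `T` (★ p541073, `LDHGenuinePerImageShellRat`, BY NAME). [cite: Mochizuki2012, IUTchI Def. 3.1 (a)(b)(c) p. 61–62; IUTchIII Cor. 3.12
p. 173–174, proof Step (x) p. 181; IUTchIV Thm. 1.10 p. 22, Step (ii) p. 24, Step (v) p. 27–29] [cite: SilvermanATAEC1994, V.5 Thm. 5.3]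
[cite: SerreLocalFields1979, Ch. III §6 Prop. 13] [claim: Mochizuki2012, status: disputed] -/
theorem cor312PerImageOf_ratPoint_sharp_wild_poleL_shell (hq0 : q ≠ 0) (hq1 : q ≠ 1) (hl : l.Prime) (h7 : 7 ≤ l)
    (hI : ∀ p ∈ I, p.Prime) (he : ∀ p ∈ I, e p ≠ 0) (hD : D = ∏ p ∈ I, p ^ e p)
    (hj : jInv q = (N : ℚ) / (D : ℚ)) (hN : N ≠ 0) (hcop : ∀ p ∈ I, ¬ p ∣ N)
    (hlI : l ∈ I) (hel : 2 ∣ e l) (hlt : ¬ l ∣ e l / 2)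
    (Psh : Finset ℕ) (a : ℕ → ℕ) (hPshI : Psh ⊆ I) (hPsh : ∀ p ∈ Psh, p ≠ 2 ∧ p ≠ l ∧ ¬ l ∣ p - 1)
    (h : (((l : ℝ) + 1) / 24 - 1 / (2 * l)) * logQAvoid (ratPoint q) {2, l} ≤
      (((l : ℝ) + 5) / 4 - 1) *
          ((∑ p ∈ I.filter (fun p => p ≠ 2 ∧ p ≠ l),
              ((if (p = 3 ∨ p = 5) ∧ 2 ∣ e p ∧ ¬ p ∣ e p / 2 then (2 : ℝ) else 1)
                - ((l * Nat.lcm (30 / Nat.gcd 30 (e p)) (if p = 3 then 2 else if p = 5 then 4 else 1) : ℕ) : ℝ)⁻¹)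
                * Real.log p)
            + Real.log 2
            + (if 3 ∈ I then 0 else 2⁻¹ * Real.log 3)
            + (if 5 ∈ I then 0 else (3 / 4 : ℝ) * Real.log 5)
            + (2 - ((l - 1 : ℕ) : ℝ)⁻¹) * Real.log l)
        + ((l : ℝ) + 5) / 4 * ∑ p ∈ Psh,
            (((a p : ℕ) : ℝ) - (p : ℝ) ^ (a p) /
                ((l * Nat.lcm (30 / Nat.gcd 30 (e p)) (if p = 3 then 2 else if p = 5 then 4 else 1) : ℕ) : ℝ)) * Real.log p
        + ((l : ℝ) + 5) / 4 * Real.log Real.pi)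
    (T : ThetaVolumeDatumAt (ratPoint q) l) : T.Cor312PerImageOf := by
  classical
  -- adapted from ★ p541073 (`cor312PerImageOf_ratPoint_sharp_wild_poleL`: the floors) and `LDHGenuinePerImageShellRat`
  -- (`cor312PerImageOf_ratPoint_shell`: the shell); merged through `cor312PerImageOf_of_le_floor_shell`
  letI := T.instFieldF; letI := T.instNumberFieldF; letI := T.instAlgebraF; letI := T.instFieldK
  letI := T.instNumberFieldK; letI := T.instAlgebraK; letI := T.instFieldFbar; letI := T.instAlgebraFbar
  letI := T.instAlgebraKFbar; letI := T.instIsElliptic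
  letI : Algebra (ratPoint q).F T.K := ((algebraMap T.F T.K).comp (algebraMap (ratPoint q).F T.F)).toAlgebra
  have hUP := ratPoint_mem_UPle_one hq0 hq1
  have hd1 : dmod (ratPoint q) = 1 := dmod_eq_one_of_degree_le_one (le_of_eq (degree_ratPoint _))
  have hl2 : l ≠ 2 := by omega
  have hl3 : l ≠ 3 := by omega
  have hl5 : l ≠ 5 := by omega
  -- the primes carrying a floor
  obtain ⟨Ps, hPs⟩ : ∃ Ps : Finset ℕ, Ps = I.filter (fun p => p ≠ 2 ∧ p ≠ l) ∪ ({2, l} ∪ ({3, 5} \ I)) := ⟨_, rfl⟩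
  have hPs_prime : ∀ p ∈ Ps, p.Prime := by
    intro p hp
    rw [hPs] at hp
    rcases Finset.mem_union.mp hp with h | h
    · exact hI p (Finset.mem_filter.mp h).1
    · rcases Finset.mem_union.mp h with h | h
      · rcases Finset.mem_insert.mp h with rfl | h
        · exact Nat.prime_two
        · rw [Finset.mem_singleton] at h; subst h; exact hl
      · have h35 := (Finset.mem_sdiff.mp h).1
        rcases Finset.mem_insert.mp h35 with rfl | h35
        · norm_num
        · rw [Finset.mem_singleton] at h35; subst h35; norm_num
  -- the floors
  obtain ⟨mA, hmA⟩ : ∃ mA : ℕ → ℕ, mA = fun p =>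
      l * Nat.lcm (30 / Nat.gcd 30 (e p)) (if p = 3 then 2 else if p = 5 then 4 else 1) := ⟨_, rfl⟩
  obtain ⟨B, hB⟩ : ∃ B : ℕ → ℝ, B = fun p =>
      if p ∈ I ∧ (p ≠ 2 ∧ p ≠ l) then
        (if (p = 3 ∨ p = 5) ∧ 2 ∣ e p ∧ ¬ p ∣ e p / 2 then (2 : ℝ) else 1) - (mA p : ℝ)⁻¹
      else if p = 2 then 1 else if p = l then 2 - ((l - 1 : ℕ) : ℝ)⁻¹
      else if p = 5 then 1 - 4⁻¹ else 1 - 2⁻¹ := ⟨_, rfl⟩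
  have hcpos : ∀ p, 0 < (if p = 3 then 2 else if p = 5 then 4 else 1 : ℕ) := by
    intro p; split_ifs <;> norm_num
  have hrpos : ∀ p, 0 < 30 / Nat.gcd 30 (e p) := fun p =>
    Nat.div_pos (Nat.gcd_le_left _ (by norm_num)) (Nat.gcd_pos_of_pos_left _ (by norm_num))
  have hlcmpos : ∀ p, 0 < Nat.lcm (30 / Nat.gcd 30 (e p)) (if p = 3 then 2 else if p = 5 then 4 else 1) :=
    fun p => Nat.lcm_pos (hrpos p) (hcpos p)
  have hmApos : ∀ p, 0 < mA p := fun p => by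
    rw [hmA]; exact Nat.mul_pos hl.pos (hlcmpos p)
  have hBA : ∀ p ∈ I.filter (fun p => p ≠ 2 ∧ p ≠ l),
      B p = (if (p = 3 ∨ p = 5) ∧ 2 ∣ e p ∧ ¬ p ∣ e p / 2 then (2 : ℝ) else 1)
        - ((l * Nat.lcm (30 / Nat.gcd 30 (e p)) (if p = 3 then 2 else if p = 5 then 4 else 1) : ℕ) : ℝ)⁻¹ := by
    intro p hp
    obtain ⟨hpI, hp2l⟩ := Finset.mem_filter.mp hp
    simp only [hB, hmA, if_pos (And.intro hpI hp2l)]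
  have hB2 : B 2 = 1 := by simp [hB]
  have hBl : B l = 2 - ((l - 1 : ℕ) : ℝ)⁻¹ := by simp [hB, hl2]
  have hB3 : 3 ∉ I → B 3 = 1 - 2⁻¹ := fun h3 => by simp [hB, h3, Ne.symm hl3]
  have hB5 : 5 ∉ I → B 5 = 1 - 4⁻¹ := fun h5 => by simp [hB, h5, Ne.symm hl5]
  -- the floors are theorems at `T.K`: ★ p541073, packaged as `floors_sharp_wild_poleL_ratPoint`
  have hfloor : ∀ p ∈ Ps, ∀ w ∈ placesOver T.K p,
      B p * (w.asIdeal.ramificationIdx ℤ : ℝ) ≤ (multiplicity w.asIdeal (differentIdeal ℤ (𝓞 T.K)) : ℝ) := by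
    intro p hp w hw
    rw [hPs] at hp
    rw [hB, hmA]
    exact T.floors_sharp_wild_poleL_ratPoint hl h7 hI he hD hj hN hcop hlI hel hlt p hp w hw
  -- the shell function: `(a_p − p^{a_p}/m_p)·log p` on `Psh`, `0` elsewhere (verbatim from `cor312PerImageOf_ratPoint_shell`'s proof)
  obtain ⟨Sf, hSf⟩ : ∃ Sf : (p : ℕ) → placesOver (fieldOfModuli T.E) p → ℝ, Sf = fun p _ =>
      if p ∈ Psh then (((a p : ℕ) : ℝ) - (p : ℝ) ^ (a p) /
        ((l * Nat.lcm (30 / Nat.gcd 30 (e p)) (if p = 3 then 2 else if p = 5 then 4 else 1) : ℕ) : ℝ)) * Real.log p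
      else 0 := ⟨_, rfl⟩
  have hMge : ∀ p ∈ Psh, l ≤ l * Nat.lcm (30 / Nat.gcd 30 (e p)) (if p = 3 then 2 else if p = 5 then 4 else 1) :=
    fun p _ => Nat.le_mul_of_pos_right _ (hlcmpos p)
  have hPshT : ∀ p ∈ Psh, p ∈ T.I.supportPrimes := by
    intro p hpP
    obtain ⟨hp2, hpl, -⟩ := hPsh p hpP
    have hpI := hPshI hpP
    have hpp := hI p hpI
    haveI : Fact p.Prime := ⟨hpp⟩
    obtain ⟨u, hu⟩ := placesOver_nonempty (fieldOfModuli T.E) p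
    have hdvd := T.weight_dvd_ramificationIdx_int_of_mem hl h7 hI he hD hj hN hcop hpI hp2 hpl
      (T.I.σ.lift u) (T.I.σ.natCast_mem_lift ⟨u, hu⟩)
    by_contra hnot
    have hdisc : ¬ (p : ℤ) ∣ NumberField.discr T.K := by
      intro hd
      apply hnot
      refine Finset.mem_union_left _ (Nat.mem_primeFactors.mpr ⟨hpp, ?_, ?_⟩)
      · exact dvd_mul_of_dvd_right (Int.natCast_dvd.mp hd) 2
      · exact mul_ne_zero two_ne_zero (Int.natAbs_ne_zero.mpr (NumberField.discr_ne_zero T.K))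
    have h1 := absRamificationIdx_rescaledCompletion_eq_one_of_not_dvd_discr T.K p (T.I.σ.lift u)
      (T.I.σ.natCast_mem_lift ⟨u, hu⟩) hdisc
    rw [absRamificationIdx_rescaledCompletion] at h1
    rw [h1] at hdvd
    have := Nat.le_of_dvd one_pos hdvd
    have := hMge p hpP
    omega
  have hS : ∀ (p : ℕ) [hp : Fact p.Prime] (u : placesOver (fieldOfModuli T.E) p),
      ∃ c z : (T.I.σ.localFieldFamily p hp.out).k u,
        c ≠ 0 ∧ (∀ o : (T.I.σ.localFieldFamily p hp.out).k u, ‖o‖ ≤ 1 → c * o ∈ logUnits _) ∧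
        (∃ (ϖ : ((T.I.σ.localFieldFamily p hp.out).k u)ˣ) (w : (T.I.σ.localFieldFamily p hp.out).k u),
          IsUniformizer ϖ ∧ w ∉ logUnits _ ∧ ‖w‖ * ‖(ϖ : (T.I.σ.localFieldFamily p hp.out).k u)‖ ≤ ‖c‖) ∧
        z ≠ 0 ∧ z ∈ logUnits _ ∧ Sf p u ≤ Real.log ‖z‖ - Real.log ‖c‖ := by
    intro p hp u
    by_cases hpP : p ∈ Psh
    · obtain ⟨hp2, hpl, hndvd⟩ := hPsh p hpP
      have hpI := hPshI hpP
      have hdvd := T.weight_dvd_ramificationIdx_int_of_mem hl h7 hI he hD hj hN hcop hpI hp2 hpl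
        (T.I.σ.lift u.1) (T.I.σ.natCast_mem_lift u)
      rw [← T.I.σ.absRamificationIdx_localFieldFamily_eq u] at hdvd
      have he0 : 0 < absRamificationIdx p ((T.I.σ.localFieldFamily p hp.out).k u) := absRamificationIdx_pos p _
      have hMle := Nat.le_of_dvd he0 hdvd
      have hldvd : l ∣ absRamificationIdx p ((T.I.σ.localFieldFamily p hp.out).k u) := (dvd_mul_right l _).trans hdvd
      have hne : ∀ a' : ℕ, (absRamificationIdx p ((T.I.σ.localFieldFamily p hp.out).k u) : ℤ) ≠
          (p : ℤ) ^ a' * ((p : ℤ) - 1) := by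
        intro a' hcontra
        have hp1 : 1 ≤ p := hp.out.pos
        have hnat : absRamificationIdx p ((T.I.σ.localFieldFamily p hp.out).k u) = p ^ a' * (p - 1) := by
          have : ((p : ℤ) - 1) = ((p - 1 : ℕ) : ℤ) := by push_cast [Nat.cast_sub hp1]; ring
          rw [this] at hcontra
          exact_mod_cast hcontra
        rw [hnat] at hldvd
        rcases (Nat.Prime.dvd_mul hl).mp hldvd with h1 | h1
        · exact hpl ((Nat.prime_dvd_prime_iff_eq hl hp.out).mp (hl.dvd_of_dvd_pow h1)).symm
        · exact hndvd h1
      obtain ⟨c, z, hc0, hc, hmax, hz0, hzΛ, hge⟩ :=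
        exists_shellPair_ge_of_forall_ne p (K := (T.I.σ.localFieldFamily p hp.out).k u) hne (a p)
      refine ⟨c, z, hc0, hc, hmax, hz0, hzΛ, le_trans ?_ hge⟩
      rw [hSf]
      simp only [if_pos hpP]
      have hlogp : 0 < Real.log p := Real.log_pos (by exact_mod_cast hp.out.one_lt)
      have hMpos : (0 : ℝ) < ((l * Nat.lcm (30 / Nat.gcd 30 (e p)) (if p = 3 then 2 else if p = 5 then 4 else 1) : ℕ) : ℝ) := by
        exact_mod_cast Nat.mul_pos hl.pos (hlcmpos p)
      have heR : (((l * Nat.lcm (30 / Nat.gcd 30 (e p)) (if p = 3 then 2 else if p = 5 then 4 else 1) : ℕ) : ℝ)) ≤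
          (absRamificationIdx p ((T.I.σ.localFieldFamily p hp.out).k u) : ℝ) := by exact_mod_cast hMle
      have hdiv : (p : ℝ) ^ (a p) / (absRamificationIdx p ((T.I.σ.localFieldFamily p hp.out).k u) : ℝ) ≤
          (p : ℝ) ^ (a p) / ((l * Nat.lcm (30 / Nat.gcd 30 (e p)) (if p = 3 then 2 else if p = 5 then 4 else 1) : ℕ) : ℝ) :=
        div_le_div_of_nonneg_left (by positivity) hMpos heR
      have hinv : (0 : ℝ) ≤ 1 / (absRamificationIdx p ((T.I.σ.localFieldFamily p hp.out).k u) : ℝ) := by positivity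
      have hcast : (((a p : ℕ) : ℝ)) = (a p : ℝ) := rfl
      nlinarith [hdiv, hinv, hlogp]
    · obtain ⟨c, z, hc0, hc, hmax, hz0, hzΛ, hnn⟩ := exists_shellPair_nonneg p (K := (T.I.σ.localFieldFamily p hp.out).k u)
      refine ⟨c, z, hc0, hc, hmax, hz0, hzΛ, le_trans ?_ hnn⟩
      rw [hSf]
      simp only [if_neg hpP, le_refl]
  have hshell : ∑ p ∈ T.I.supportPrimes, (((l : ℝ) + 5) / 4) *
        ∑ u : placesOver (fieldOfModuli T.E) p, weight (fieldOfModuli T.E) u.1 * Sf p u =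
      ((l : ℝ) + 5) / 4 * ∑ p ∈ Psh,
        (((a p : ℕ) : ℝ) - (p : ℝ) ^ (a p) /
          ((l * Nat.lcm (30 / Nat.gcd 30 (e p)) (if p = 3 then 2 else if p = 5 then 4 else 1) : ℕ) : ℝ)) * Real.log p := by
    rw [← Finset.mul_sum]
    congr 1
    have h1 : ∀ p ∈ T.I.supportPrimes, ∑ u : placesOver (fieldOfModuli T.E) p, weight (fieldOfModuli T.E) u.1 * Sf p u =
        if p ∈ Psh then (((a p : ℕ) : ℝ) - (p : ℝ) ^ (a p) /
          ((l * Nat.lcm (30 / Nat.gcd 30 (e p)) (if p = 3 then 2 else if p = 5 then 4 else 1) : ℕ) : ℝ)) * Real.log p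
        else 0 := by
      intro p hpT
      haveI : Fact p.Prime := ⟨T.I.prime_of_mem_supportPrimes hpT⟩
      rw [hSf]
      by_cases hpP : p ∈ Psh
      · simp only [if_pos hpP]
        rw [← Finset.sum_mul]
        have hw : ∑ u : placesOver (fieldOfModuli T.E) p, weight (fieldOfModuli T.E) u.1 = 1 :=
          (localWeights (fieldOfModuli T.E) p).sum_pr
        rw [hw, one_mul]
      · simp only [if_neg hpP, mul_zero, Finset.sum_const_zero]
    rw [Finset.sum_congr rfl h1, ← Finset.sum_filter]
    congr 1
    ext p
    simp only [Finset.mem_filter]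
    exact ⟨fun h => h.2, fun h => ⟨hPshT p h, h⟩⟩
  -- assemble with the floors+shell sufficiency
  refine T.cor312PerImageOf_of_le_floor_shell hUP.1.1
    (by rw [hd1]; have : (7 : ℝ) ≤ l := by exact_mod_cast h7
        push_cast; linarith) Ps hPs_prime B hfloor Sf hS ?_
  have harch : ThetaVolumeInput.archLogTheta l = ((l : ℝ) + 5) / 4 * Real.log Real.pi := rfl
  rw [harch, hd1, hPs, sum_floor_eq_fs h7 B hBA hB2 hBl hB3 hB5, Nat.cast_one, hshell]
  exact h

end Literature.IUT.LogVolume.Cor22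

end
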